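import Summits.ResolutionOfSingularities.ResolutionOfSingularities.Theorems.HomologicalConductorNoZenoRebase
import HarnessLib

/-!
# Crux `NoZeno` (stmt-ResolutionOfSingularities-16483), line `birth`: the induction step on the transcendence degree

Companion of `Theorems/HomologicalConductorNoZenoRebase.lean` (re-basing lemmas). Proves
`exists_regular_of_residually_transcendental_mem_tower_of_IH`: assuming termination of the
canonical normalised `ca`-tower for every datum of smaller transcendence degree over EVERY field of
characteristic `p` (legitimate inside `NoZeno_of`, the route cruxes `Persistence`/`StrictDrop`
being universal over all fields), a stage `T_m` holding an element `s` whose residue in `κ(O)` is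
transcendental over `k` forces a regular stage: `k(s) ⊆ T_m`, the tower from stage `m` on is the
`k(s)`-tower of a finitely generated `k(s)`-model of `T_m` (tower shape + re-basing), and
`tr.deg_{k(s)} K < tr.deg_k K`. For the trdeg-≥-3 stubs this is the free normalisation «every
stage is zero-dimensional over `k`» (KERNEL-L0 §8).

References: O. Zariski, P. Samuel, *Commutative Algebra* II, VI §14 [`ZariskiSamuel1960`].
-/

noncomputable section

-- single-problem summit: the doubled namespace component `ResolutionOfSingularities` is forced
set_option linter.dupNamespace false

namespace Summit.ResolutionOfSingularities.ResolutionOfSingularities.Theorems.NoZeno.Birth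

open Summit.ResolutionOfSingularities.ResolutionOfSingularities.Theses.HomologicalConductor
open Literature.AlgebraicGeometry.Resolution Literature.RingTheory.CohomologyAnnihilator Polynomial

variable {k K : Type} [Field k] [Field K] [Algebra k K]

/-- **Induction step over the transcendence degree (re-basing to `k(s)`).** Assume termination of
the canonical tower for every datum, over every field of characteristic `p`, of transcendence
degree smaller than `tr.deg_k K` (`IH`). If some stage `T_m` of the tower of `A ⊆ O` contains an
element `s` whose residue in `κ(O)` is transcendental over `k` (no non-zero `f ∈ k[X]` has
`v(f(s)) > 0`), then the tower reaches a regular local ring. Proof: every non-zero `f(s)` is an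
`O`-unit of `T_m = loc O T_m`, so `F = k(s) ⊆ T_m`; `T_m = loc O D` for a finitely generated
`D ⊇ A` (tower shape), and `A'' = F[D] ⊆ T_m` is a finitely generated `F`-model of `K` inside `O`
with `loc O A'' = T_m`; `tr.deg_F K = tr.deg_k K − tr.deg_k F < tr.deg_k K`; by `IH` the `F`-tower
of `A''` reaches a regular stage, and its stages have the same carriers as `T_m, T_(m+1), …`
(`rb_tower_toSubring_eq`, `tower_tower`). [cite: ZariskiSamuel1960, Ch. VI §14] -/
theorem exists_regular_of_residually_transcendental_mem_tower_of_IH (p : ℕ) (hp : p.Prime)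
    (k K : Type) [Field k] [CharP k p] [Field K] [Algebra k K] (O : ValuationSubring K)
    (A : Subalgebra k K) (hk : ∀ c : k, algebraMap k K c ∈ O) (hA : A.FG)
    (hfr : IsFractionRing ↥A K) (hAO : A.toSubring ≤ O.toSubring)
    (IH : ∀ (k' K' : Type) [Field k'] [CharP k' p] [Field K'] [Algebra k' K']
      (O' : ValuationSubring K') (A' : Subalgebra k' K'), (∀ c : k', algebraMap k' K' c ∈ O') →
      A'.FG → IsFractionRing ↥A' K' → A'.toSubring ≤ O'.toSubring →
      Algebra.trdeg k' K' < Algebra.trdeg k K → ∃ m : ℕ, IsRegularLocalRing ↥(tower O' A' m))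
    {s : K} (hval : ∀ f : k[X], f ≠ 0 → ¬ O.valuation (aeval s f) < 1) (m : ℕ)
    (hsm : s ∈ tower O A m) :
    ∃ m' : ℕ, IsRegularLocalRing ↥(tower O A m') := by
  classical
  haveI := hfr
  set T := tower O A m with hTdef
  have hTO : T.toSubring ≤ O.toSubring :=
    fun x hx => mem_valuationSubring_of_mem_tower O hk hAO m x hx
  -- `O`-units of the stage are inverted in the stage
  have hinv : ∀ {x : K}, x ∈ T → x⁻¹ ∈ O → x⁻¹ ∈ T := by
    intro x hx hxO
    by_cases hx0 : x = 0
    · rw [hx0, inv_zero]; exact T.zero_mem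
    obtain ⟨B, hBO, hTB⟩ := exists_tower_eq_loc O A hk hAO m
    have hxO' : x ∈ O := hTO hx
    rw [hTdef, hTB, loc_eq_locAt] at hx ⊢
    exact SyzygyFlattening.inv_mem_locAt O B hBO hx
      (SyzygyFlattening.valuation_eq_one_of_inv_mem O hxO' hxO hx0)
  -- `s` is transcendental over `k`, `k[s] ⊆ T`, non-zero `f(s)` inverted in `T`, `k(s) ⊆ T`
  have hs : Transcendental k s := by
    rintro ⟨f, hf0, hf⟩
    exact hval f hf0 (by rw [hf, map_zero]; exact zero_lt_one)
  have hpoly : ∀ f : k[X], aeval s f ∈ T := fun f =>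
    (Algebra.adjoin_le (Set.singleton_subset_iff.mpr hsm) : Algebra.adjoin k {s} ≤ T)
      (by rw [Algebra.adjoin_singleton_eq_range_aeval]; exact ⟨f, rfl⟩)
  have hunit : ∀ f : k[X], f ≠ 0 → (aeval s f)⁻¹ ∈ T := by
    intro f hf0
    refine hinv (hpoly f) ?_
    have hle : O.valuation (aeval s f) ≤ 1 := (O.valuation_le_one_iff _).mpr (hTO (hpoly f))
    have heq : O.valuation (aeval s f) = 1 := le_antisymm hle (not_lt.mp (hval f hf0))
    rw [← O.valuation_le_one_iff, map_inv₀, heq, inv_one]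
  set F : IntermediateField k K := IntermediateField.adjoin k ({s} : Set K) with hFdef
  have hFT : ∀ x : K, x ∈ F → x ∈ T := by
    intro x hx
    obtain ⟨r, q, rfl⟩ := (IntermediateField.mem_adjoin_simple_iff k x).mp hx
    by_cases hq : q = 0
    · rw [hq, map_zero, div_zero]; exact T.zero_mem
    · rw [div_eq_mul_inv]; exact T.mul_mem (hpoly r) (hunit q hq)
  have hFO : ∀ c : ↥F, algebraMap (↥F) K c ∈ O := fun c => hTO (hFT c c.2)
  haveI : CharP (↥F) p := charP_of_injective_algebraMap (algebraMap k ↥F).injective p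
  -- a finitely generated `k`-model `D ⊇ A` of the stage: `loc O D = T`
  have hshape := StrictDrop.Birth.TowerShape.stub_towerShape p hp k K O A hk hA hfr hAO
  obtain ⟨⟨D₀, hD₀fg, hD₀T, hlocD₀, -⟩, -, -, -⟩ := hshape m
  change loc O D₀ = T at hlocD₀
  set D : Subalgebra k K := D₀ ⊔ A with hDdef
  have hDfg : D.FG := hD₀fg.sup hA
  have hAT : A ≤ T := (tn_tower_invariant O A hk hA hfr hAO m).1
  have hDT : D ≤ T := sup_le hD₀T hAT
  have hDO : D.toSubring ≤ O.toSubring := fun x hx => hTO (hDT hx)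
  have hlocT : loc O T = T := SurfaceTermination.Regimes.loc_tower O A hk hAO m
  have hlocD : loc O D = T := by
    refine le_antisymm ?_ ?_
    · have h := SyzygyFlattening.locAt_mono O hDT
      rw [← loc_eq_locAt, ← loc_eq_locAt, hlocT] at h
      exact h
    · have h := SyzygyFlattening.locAt_mono O (le_sup_left : D₀ ≤ D)
      rw [← loc_eq_locAt, ← loc_eq_locAt, hlocD₀] at h
      exact h
  haveI : IsFractionRing ↥D K := isFractionRing_subalgebra_of_le A D le_sup_right
  -- the `F`-model `A'' = F[D]`
  obtain ⟨G, hG⟩ := hDfg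
  set A'' : Subalgebra (↥F) K := Algebra.adjoin (↥F) (G : Set K) with hA''def
  have hA''fg : A''.FG := ⟨G, rfl⟩
  have hDA'' : (D : Set K) ⊆ (A'' : Set K) := by
    rw [← hG]
    change ((Algebra.adjoin k (G : Set K)).toSubring : Set K) ⊆ (A''.toSubring : Set K)
    rw [Algebra.adjoin_eq_ring_closure, hA''def, Algebra.adjoin_eq_ring_closure]
    refine Subring.closure_mono (Set.union_subset_union_left _ ?_)
    rintro _ ⟨c, rfl⟩
    exact ⟨algebraMap k ↥F c, (IsScalarTower.algebraMap_apply k ↥F K c).symm⟩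
  -- `T` re-based to `F`
  let T'' : Subalgebra (↥F) K :=
    { T.toSubring with algebraMap_mem' := fun c => hFT c c.2 }
  have hT'' : T''.toSubring = T.toSubring := rfl
  have hA''T : A'' ≤ T'' := by
    rw [hA''def]
    refine Algebra.adjoin_le fun g hg => ?_
    change g ∈ T
    exact hDT (hG ▸ Algebra.subset_adjoin hg)
  have hA''O : A''.toSubring ≤ O.toSubring := fun x hx => hTO (hA''T hx)
  -- `Frac A'' = K`: `A''` contains `D` (viewed over `k`)
  let A''k : Subalgebra k K :=
    { A''.toSubring with
      algebraMap_mem' := fun c => hDA'' (D.algebraMap_mem c) }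
  have hDA''k : D ≤ A''k := fun x hx => hDA'' hx
  have hA''fr : IsFractionRing ↥A'' K := isFractionRing_subalgebra_of_le D A''k hDA''k
  -- `loc O A'' = T` (carriers)
  have hlocA'' : (loc O A'').toSubring = T.toSubring := by
    rw [rb_loc_toSubring_eq O A''k A'' rfl]
    refine le_antisymm ?_ ?_
    · have h := SyzygyFlattening.locAt_mono O (show A''k ≤ T from fun x hx => hA''T hx)
      rw [← loc_eq_locAt, ← loc_eq_locAt, hlocT] at h
      exact h
    · have h := SyzygyFlattening.locAt_mono O hDA''k
      rw [← loc_eq_locAt, ← loc_eq_locAt, hlocD] at h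
      exact h
  -- `tr.deg_F K < tr.deg_k K`
  have hlt : Algebra.trdeg (↥F) K < Algebra.trdeg k K := by
    haveI : Algebra.FiniteType k ↥A := A.fg_iff_finiteType.mp hA
    have hfg : (⊤ : IntermediateField k K).FG :=
      IntermediateField.fg_top_of_isFractionRing_of_finiteType k ↥A K
    have hfin : Algebra.trdeg k K < Cardinal.aleph0 := trdeg_lt_aleph0_of_fg hfg
    haveI : FaithfulSMul k ↥F :=
      (faithfulSMul_iff_algebraMap_injective k ↥F).mpr (algebraMap k ↥F).injective
    haveI : FaithfulSMul ↥F K :=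
      (faithfulSMul_iff_algebraMap_injective ↥F K).mpr (algebraMap ↥F K).injective
    have hs' : Transcendental k (⟨s, IntermediateField.mem_adjoin_simple_self k s⟩ : ↥F) :=
      fun h => hs (by simpa using h.algebraMap (A := K))
    haveI : Algebra.Transcendental k ↥F := ⟨⟨_, hs'⟩⟩
    have h1 : 1 ≤ Algebra.trdeg k ↥F := Cardinal.one_le_iff_pos.mpr (trdeg_pos k ↥F)
    have hadd : Algebra.trdeg k ↥F + Algebra.trdeg ↥F K = Algebra.trdeg k K :=
      trdeg_add_eq k ↥F (A := K)
    obtain ⟨n, hn⟩ := Cardinal.lt_aleph0.mp hfin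
    obtain ⟨a, ha⟩ := Cardinal.lt_aleph0.mp
      ((le_self_add.trans_eq hadd).trans_lt hfin : Algebra.trdeg k ↥F < Cardinal.aleph0)
    obtain ⟨b, hb⟩ := Cardinal.lt_aleph0.mp
      ((le_add_self.trans_eq hadd).trans_lt hfin : Algebra.trdeg ↥F K < Cardinal.aleph0)
    rw [ha, hb, hn] at hadd
    rw [ha] at h1
    rw [hb, hn]
    have hadd' : a + b = n := by exact_mod_cast hadd
    have h1' : 1 ≤ a := by exact_mod_cast h1
    exact_mod_cast (by omega : b < n)
  -- the induction hypothesis over `F`, transported back along equal carriers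
  obtain ⟨j, hj⟩ := IH (↥F) K O A'' hFO hA''fg hA''fr hA''O hlt
  have hcar : ∀ j : ℕ, (tower O A'' j).toSubring = (tower O A (m + j)).toSubring := by
    intro j
    have h0 : (tower O A'' 0).toSubring = (tower O T'' 0).toSubring := by
      rw [tower_zero, tower_zero, hlocA'', ← hT'']
      have : loc O T'' = T'' := by
        apply le_antisymm
        · intro x hx
          have h := rb_loc_toSubring_eq O T T'' hT''
          have hx' : x ∈ (loc O T'').toSubring := hx
          rw [h] at hx'
          change x ∈ (loc O T).toSubring at hx'
          rw [hlocT] at hx'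
          exact hx'
        · rw [loc_eq_locAt]; exact SyzygyFlattening.self_le_locAt O T''
      rw [this]
    -- both towers satisfy the same recursion on carriers; compare with the tower of `T''`
    have hA''T'' : ∀ j, (tower O A'' j).toSubring = (tower O T'' j).toSubring := by
      intro j
      induction j with
      | zero => exact h0
      | succ j ih =>
        rw [tower_succ, tower_succ]
        -- `loc O (nrm (chart O X))` depends only on the carrier of `X` (same base field `F`)
        have hc : (chart O (tower O A'' j)).toSubring = (chart O (tower O T'' j)).toSubring := by
          have hmem : ∀ x : K, x ∈ tower O A'' j ↔ x ∈ tower O T'' j := fun x => by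
            change x ∈ (tower O A'' j).toSubring ↔ x ∈ (tower O T'' j).toSubring
            rw [ih]
          have hcoe : ((tower O A'' j : Subalgebra (↥F) K) : Set K) = (tower O T'' j : Set K) :=
            Set.ext hmem
          have hca : ca (tower O A'' j) = ca (tower O T'' j) := by
            let Tk : Subalgebra k K :=
              { (tower O T'' j).toSubring with
                algebraMap_mem' := fun c => by
                  have : algebraMap k K c = algebraMap (↥F) K (algebraMap k (↥F) c) :=
                    IsScalarTower.algebraMap_apply k (↥F) K c
                  rw [this]; exact (tower O T'' j).algebraMap_mem _ }
            rw [rb_ca_eq Tk (tower O A'' j) ih, rb_ca_eq Tk (tower O T'' j) rfl]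
          unfold chart
          rw [hcoe, hca]
        have hn : (nrm (chart O (tower O A'' j))).toSubring =
            (nrm (chart O (tower O T'' j))).toSubring := by
          have hS : {y : K | IsIntegral ↥(chart O (tower O A'' j)) y} =
              {y : K | IsIntegral ↥(chart O (tower O T'' j)) y} := by
            ext y
            change IsIntegral ↥(chart O (tower O A'' j)).toSubring y ↔
              IsIntegral ↥(chart O (tower O T'' j)).toSubring y
            rw [hc]
          unfold nrm
          rw [hS]
        have hmem : ∀ x : K, x ∈ nrm (chart O (tower O A'' j)) ↔
            x ∈ nrm (chart O (tower O T'' j)) := fun x => by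
          change x ∈ (nrm (chart O (tower O A'' j))).toSubring ↔
            x ∈ (nrm (chart O (tower O T'' j))).toSubring
          rw [hn]
        have hS : {y : K | ∃ a ∈ nrm (chart O (tower O A'' j)), ∃ s ∈ nrm (chart O (tower O A'' j)),
            s⁻¹ ∈ O ∧ y = a * s⁻¹} = {y : K | ∃ a ∈ nrm (chart O (tower O T'' j)),
            ∃ s ∈ nrm (chart O (tower O T'' j)), s⁻¹ ∈ O ∧ y = a * s⁻¹} := by
          ext y
          simp only [Set.mem_setOf_eq, hmem]
        unfold loc
        rw [hS]
    rw [hA''T'' j, rb_tower_toSubring_eq O T T'' hT'' j]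
    have ht := tower_tower O A hk hAO m j
    rw [← hTdef] at ht
    rw [ht]
  exact ⟨m + j, IsRegularLocalRing.of_ringEquiv (RingEquiv.subringCongr (hcar j))⟩

end Summit.ResolutionOfSingularities.ResolutionOfSingularities.Theorems.NoZeno.Birth

end
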